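import Summits.AtomisticToContinuum.Crystallization.Theses.ChessboardParticlePlanes
import Literature.MathematicalPhysics.StatisticalMechanics.PeriodicConfigurationSums

/-!
# Crux `ChessboardParticlePlanes.LjPlaneChessboard` (stmt-AtomisticToContinuum-6709), line `Sketch`,
# stub `siteSum_layers_Q` — the Lennard-Jones site sum of `Q` in layer form

Let `Q` be a periodic configuration of `ℝ³` whose occupied heights (third coordinates of its
points) are enumerated by a strictly increasing `z : ℤ → ℝ`, and let `x ∈ Q.points` lie on the
plane `i₀` (`x 2 = z i₀`).  ASSUMING the height splitting of a site sum (the statement of the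
sibling stub `siteSum_heightSplit`, taken here as an explicit hypothesis): for every periodic
configuration `P`, point `x` and strictly increasing enumeration `H` covering the heights of `P`,
each plane sum `L i = Σ'_{y ∈ P, y 2 = H i, y ≠ x} V_LJ(|x - y|)` is summable, `i ↦ L i` is
summable, and `Σ'_{y ∈ P, y ≠ x} V_LJ(|x - y|) = Σ'_i L i`; THEN the site sum of `Q` at `x` is
its in-plane part plus the cross-plane layer sums,

  `Σ'_{y ∈ Q, y ≠ x} V_LJ(|x - y|) = Σ'_{y ∈ Q, y 2 = x 2, y ≠ x} V_LJ(|x - y|)`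
  `  + Σ'_{m ≠ i₀} Σ'_{y ∈ Q, y 2 = z m} V_LJ(√(‖x - y‖² - (x 2 - z m)² + (z i₀ - z m)²))`,

with the outer family over `m ≠ i₀` summable.  (Since `x 2 = z i₀` the square root is just
`‖x - y‖`; the form `√(horizontal² + offset²)` is kept for the later planar analysis.)  [folklore]

PROOF.  Apply the hypothesis with `P := Q`, `H := z`: the site sum is `Σ'_i L i`.  Split off the
term `i = i₀` (`Summable.tsum_subtype_add_tsum_subtype_compl` with the set `{i₀}`,
`tsum_singleton`); `L i₀` is the in-plane sum after rewriting `x 2 = z i₀`; for `m ≠ i₀` the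
condition `y ≠ x` in `L m` is automatic (`y 2 = z m ≠ z i₀ = x 2` by injectivity of `z`), so the
index subtypes are equivalent (`Equiv.subtypeEquivRight`, `Equiv.tsum_eq`) and the summands agree
(`Real.sqrt_sq`, `dist_eq_norm`).  Summability of the outer family is the summability of `L`
restricted to `{m // m ≠ i₀}` (`Summable.subtype`).  No definition is introduced.
-/

noncomputable section

namespace Summit.AtomisticToContinuum.Crystallization.Theorems.ChessboardParticlePlanesLjPlaneChessboard

open Literature.MathematicalPhysics.StatisticalMechanics

/-- Splitting one term off a summable series over `ℤ`: `Σ'_i f i = f i₀ + Σ'_{m ≠ i₀} f m`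
(`Summable.tsum_subtype_add_tsum_subtype_compl` with `s = {i₀}` and `tsum_singleton`; the
complement subtype `↥{i₀}ᶜ` is `{m // m ≠ i₀}` by definition). [folklore] -/
theorem siteSumQ_tsum_eq_add_tsum_ne {f : ℤ → ℝ} (hf : Summable f) (i₀ : ℤ) :
    ∑' i, f i = f i₀ + ∑' m : {m : ℤ // m ≠ i₀}, f m := by
  rw [← hf.tsum_subtype_add_tsum_subtype_compl {i₀}, tsum_singleton]
  rfl

/-- **The site sum of `Q` in layer form** (R1c-Q of line `Sketch`).  Under the height-splitting
hypothesis (sibling stub `siteSum_heightSplit`, stated verbatim as the first arrow), for a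
periodic configuration `Q` of `ℝ³` with strictly increasing height enumeration `z` covering the
heights of its points and a point `x ∈ Q.points` with `x 2 = z i₀`:
`Σ'_{y ∈ Q, y ≠ x} V_LJ(|x - y|) = Σ'_{y ∈ Q, y 2 = x 2, y ≠ x} V_LJ(|x - y|)
 + Σ'_{m ≠ i₀} Σ'_{y ∈ Q, y 2 = z m} V_LJ(√(‖x - y‖² - (x 2 - z m)² + (z i₀ - z m)²))`,
and the outer family over `m ≠ i₀` is summable. [folklore] -/
theorem siteSum_layers_Q :
    (∀ (P : PeriodicConfiguration 3) (x : EuclideanSpace ℝ (Fin 3)) (H : ℤ → ℝ), StrictMono H →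
      (∀ y ∈ P.points, ∃ i : ℤ, y 2 = H i) →
      (∀ i : ℤ, Summable (fun y : {y : EuclideanSpace ℝ (Fin 3) // y ∈ P.points ∧ y 2 = H i ∧ y ≠ x} =>
          lennardJones (dist x y.1))) ∧
      Summable (fun i : ℤ => ∑' y : {y : EuclideanSpace ℝ (Fin 3) // y ∈ P.points ∧ y 2 = H i ∧ y ≠ x},
          lennardJones (dist x y.1)) ∧
      ∑' y : {y : EuclideanSpace ℝ (Fin 3) // y ∈ P.points ∧ y ≠ x}, lennardJones (dist x y.1) =
        ∑' i : ℤ, ∑' y : {y : EuclideanSpace ℝ (Fin 3) // y ∈ P.points ∧ y 2 = H i ∧ y ≠ x},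
          lennardJones (dist x y.1)) →
    ∀ (Q : PeriodicConfiguration 3) (z : ℤ → ℝ) (i₀ : ℤ) (x : EuclideanSpace ℝ (Fin 3)),
      StrictMono z → (∀ y ∈ Q.points, ∃ i : ℤ, y 2 = z i) → x ∈ Q.points → x 2 = z i₀ →
      Summable (fun m : {m : ℤ // m ≠ i₀} =>
        ∑' y : {y : EuclideanSpace ℝ (Fin 3) // y ∈ Q.points ∧ y 2 = z m},
          lennardJones (Real.sqrt (‖x - y.1‖ ^ 2 - (x 2 - z m) ^ 2 + (z i₀ - z m) ^ 2))) ∧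
      ∑' y : {y : EuclideanSpace ℝ (Fin 3) // y ∈ Q.points ∧ y ≠ x}, lennardJones (dist x y.1) =
        (∑' y : {y : EuclideanSpace ℝ (Fin 3) // y ∈ Q.points ∧ y 2 = x 2 ∧ y ≠ x},
            lennardJones (dist x y.1)) +
        ∑' m : {m : ℤ // m ≠ i₀},
          ∑' y : {y : EuclideanSpace ℝ (Fin 3) // y ∈ Q.points ∧ y 2 = z m},
            lennardJones (Real.sqrt (‖x - y.1‖ ^ 2 - (x 2 - z m) ^ 2 + (z i₀ - z m) ^ 2)) := by
  intro hsplit Q z i₀ x hz hcov _hx hxz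
  obtain ⟨-, hsum, heq⟩ := hsplit Q x z hz hcov
  -- the summand: since `x 2 = z i₀`, the square root is `‖x - y‖ = dist x y`
  have hsq : ∀ (m : ℤ) (y : EuclideanSpace ℝ (Fin 3)),
      Real.sqrt (‖x - y‖ ^ 2 - (x 2 - z m) ^ 2 + (z i₀ - z m) ^ 2) = dist x y := by
    intro m y
    rw [hxz, sub_add_cancel, Real.sqrt_sq (norm_nonneg _), dist_eq_norm]
  -- for `m ≠ i₀` the layer sum is the `m`-th term of the height splitting
  have hlayer : ∀ m : ℤ, m ≠ i₀ →
      ∑' y : {y : EuclideanSpace ℝ (Fin 3) // y ∈ Q.points ∧ y 2 = z m},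
          lennardJones (Real.sqrt (‖x - y.1‖ ^ 2 - (x 2 - z m) ^ 2 + (z i₀ - z m) ^ 2)) =
        ∑' y : {y : EuclideanSpace ℝ (Fin 3) // y ∈ Q.points ∧ y 2 = z m ∧ y ≠ x},
          lennardJones (dist x y.1) := by
    intro m hm
    -- on the plane `m ≠ i₀` no point equals `x`
    have hne : ∀ y : EuclideanSpace ℝ (Fin 3), y ∈ Q.points ∧ y 2 = z m → y ≠ x := by
      intro y hy hyx
      apply hm
      apply hz.injective
      rw [← hy.2, hyx, hxz]
    calc ∑' y : {y : EuclideanSpace ℝ (Fin 3) // y ∈ Q.points ∧ y 2 = z m},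
          lennardJones (Real.sqrt (‖x - y.1‖ ^ 2 - (x 2 - z m) ^ 2 + (z i₀ - z m) ^ 2))
        = ∑' y : {y : EuclideanSpace ℝ (Fin 3) // y ∈ Q.points ∧ y 2 = z m},
            lennardJones (dist x y.1) := tsum_congr fun y => by rw [hsq]
      _ = ∑' y : {y : EuclideanSpace ℝ (Fin 3) // y ∈ Q.points ∧ y 2 = z m ∧ y ≠ x},
            lennardJones (dist x y.1) :=
          (Equiv.subtypeEquivRight fun y =>
              (⟨fun h => ⟨h.1, h.2, hne y h⟩, fun h => ⟨h.1, h.2.1⟩⟩ :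
                (y ∈ Q.points ∧ y 2 = z m) ↔ (y ∈ Q.points ∧ y 2 = z m ∧ y ≠ x))).tsum_eq
            (fun y : {y : EuclideanSpace ℝ (Fin 3) // y ∈ Q.points ∧ y 2 = z m ∧ y ≠ x} =>
              lennardJones (dist x y.1))
  refine ⟨(hsum.subtype fun m => m ≠ i₀).congr fun m => (hlayer m.1 m.2).symm, ?_⟩
  rw [heq, siteSumQ_tsum_eq_add_tsum_ne hsum i₀]
  congr 1
  · -- the in-plane part: the plane `i₀` is the plane of `x`
    rw [hxz]
  · exact tsum_congr fun m => (hlayer m.1 m.2).symm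

end Summit.AtomisticToContinuum.Crystallization.Theorems.ChessboardParticlePlanesLjPlaneChessboard

end
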